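import Summits.KontsevichZagierPeriods.KontsevichZagierPeriods.Theorems.LinRedNormalFormArrangementNormalFormSeparateThreeHHKRay
import Summits.KontsevichZagierPeriods.KontsevichZagierPeriods.Theorems.LinRedNormalFormArrangementNormalFormSeparateThreeHHKWeight
import Summits.KontsevichZagierPeriods.KontsevichZagierPeriods.Theorems.LinRedNormalFormArrangementNormalFormSeparateTwoHISector

/-!
# The density on a nested thin sector: sector integrals and nested affine values

(Line `janus-bands`, crux `ArrangementNormalForm`, stub `stub_separateHigh`, part `HHKSector` of
the wall-invariant termwise-split lemma `separateThree_hHk` in base dimension `3` with fibres.)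
Glue between the nested-sector chart (part `HHKChart`) and the ray theorems (part `HHKRay`) for
the density (pointwise conversions are those of part `HISector`: `SepTwo.piece_eq_wt`) `g = 𝟙_Y (∑_{i<N} |Ri i|) · m` of the Taylor pieces against the fibre mass `m` on the
(effective) base polyhedron `Y ⊆ ℝ³`:
* `nsector_zero` / `nsector_finite` (registered as `separateThreeHHK_sector`): a nested sector
  missing `Y` carries no mass; for a nested sector inside `Y` the mass is finite as soon as every
  piece is finite in blown-up coordinates `(t, v, u)` (Jacobian `t² v`);
* `hfin_of_inside3`: the finiteness hypothesis of the ray theorems from the global finiteness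
  `∫⁻_Y |R| m < ∞`;
* NESTED AFFINE VALUES: along the sector every linear form takes the value
  `t (α + v (β + u γ))` with `(α, β, γ)` its values on the frame; `α + v (β + u γ)` factors as
  `v^{evx α} u^{eux α β} · unx` with a regular factor `unx` bounded above and below near the corner
  (`nest_factor`, `unx_bounds`) — this is what makes every wall monomial in the chart.
-/

noncomputable section

open Set MeasureTheory
open scoped ENNReal

namespace Summit.KontsevichZagierPeriods.ArrangementNormalForm.JanusBands

namespace SepHHK

open SepTwo

/-- The density `g = 𝟙_Y (∑_{i<N} |Ri i|) · m` on the base `ℝ³` is measurable. -/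
theorem measurable_g3 {Y : Set (Fin 3 → ℝ)} {m : (Fin 3 → ℝ) → ℝ≥0∞} {Ri : ℕ → (Fin 3 → ℝ) → ℝ}
    (N : ℕ) (hY : MeasurableSet Y) (hm : Measurable m) (hRi : ∀ i, Measurable (Ri i)) :
    Measurable fun x : Fin 3 → ℝ =>
      Y.indicator (fun x => (∑ i ∈ Finset.range N, ENNReal.ofReal |Ri i x|) * m x) x := by
  refine Measurable.indicator ?_ hY
  refine Measurable.mul (Finset.measurable_sum _ fun i _ => ?_) hm
  exact ENNReal.measurable_ofReal.comp (continuous_abs.measurable.comp (hRi i))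

variable (Y : Set (Fin 3 → ℝ)) (m : (Fin 3 → ℝ) → ℝ≥0∞) (Ri : ℕ → (Fin 3 → ℝ) → ℝ) (N : ℕ)
  (z₁ d Q S : Fin 3 → ℝ)

/-! ### Measurability -/

/-- The blow-up point is jointly measurable. -/
theorem measurable_npt : Measurable fun p : ℝ × ℝ × ℝ => npt z₁ d Q S p.1 p.2.1 p.2.2 :=
  (continuous_npt z₁ d Q S).measurable

variable {m Ri}

/-- The piece integrand in blown-up coordinates is jointly measurable. -/
theorem measurable_piece_npt (hm : Measurable m) (hRi : ∀ i, Measurable (Ri i)) (i : ℕ) :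
    Measurable fun p : ℝ × ℝ × ℝ => ENNReal.ofReal (p.1 ^ 2 * p.2.1) *
      (ENNReal.ofReal |Ri i (npt z₁ d Q S p.1 p.2.1 p.2.2)| * m (npt z₁ d Q S p.1 p.2.1 p.2.2)) := by
  have h1 : Measurable fun p : ℝ × ℝ × ℝ => ENNReal.ofReal |Ri i (npt z₁ d Q S p.1 p.2.1 p.2.2)| :=
    ENNReal.measurable_ofReal.comp (continuous_abs.measurable.comp ((hRi i).comp
      (measurable_npt z₁ d Q S)))
  exact (ENNReal.measurable_ofReal.comp ((measurable_fst.pow_const 2).mul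
    (measurable_fst.comp measurable_snd))).mul (h1.mul (hm.comp (measurable_npt z₁ d Q S)))

variable {Y}

/-! ### The sector integral -/

/-- **A nested sector missing the base polyhedron carries no mass.** -/
theorem nsector_zero (hY : MeasurableSet Y) (hm : Measurable m) (hRi : ∀ i, Measurable (Ri i))
    (hdet : det3 d Q S ≠ 0) {δt δ ε : ℝ}
    (hout : ∀ t ∈ Ioo (0 : ℝ) δt, ∀ v ∈ Ioo (0 : ℝ) δ, ∀ u ∈ Ioo (0 : ℝ) ε, npt z₁ d Q S t v u ∉ Y) :
    ∫⁻ z in nsector z₁ d Q S δt δ (Ico 0 ε),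
      Y.indicator (fun x => (∑ i ∈ Finset.range N, ENNReal.ofReal |Ri i x|) * m x) z = 0 := by
  rw [lintegral_nsector_Ico z₁ d Q S hdet δt δ ε _ (measurable_g3 N hY hm hRi)]
  have h : ∀ t ∈ Ioo (0 : ℝ) δt, ∫⁻ v in Ioo 0 δ, ∫⁻ u in Ioo 0 ε, ENNReal.ofReal (t ^ 2 * v) *
      Y.indicator (fun x => (∑ i ∈ Finset.range N, ENNReal.ofReal |Ri i x|) * m x)
        (npt z₁ d Q S t v u) = 0 := by
    intro t ht
    rw [setLIntegral_congr_fun measurableSet_Ioo fun v hv =>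
      setLIntegral_congr_fun measurableSet_Ioo fun u hu => by
        rw [indicator_of_notMem (hout t ht v hv u hu), mul_zero]]
    simp
  rw [setLIntegral_congr_fun measurableSet_Ioo h]
  simp

/-- **A nested sector inside the base polyhedron: finiteness from the pieces in blown-up
coordinates.** -/
theorem nsector_finite (hY : MeasurableSet Y) (hm : Measurable m) (hRi : ∀ i, Measurable (Ri i))
    (hdet : det3 d Q S ≠ 0) {δt δ ε : ℝ}
    (hin : ∀ t ∈ Ioo (0 : ℝ) δt, ∀ v ∈ Ioo (0 : ℝ) δ, ∀ u ∈ Ioo (0 : ℝ) ε, npt z₁ d Q S t v u ∈ Y)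
    (hpieces : ∀ i ∈ Finset.range N, ∫⁻ t in Ioo 0 δt, ∫⁻ v in Ioo 0 δ, ∫⁻ u in Ioo 0 ε,
      ENNReal.ofReal (t ^ 2 * v) * (ENNReal.ofReal |Ri i (npt z₁ d Q S t v u)| *
        m (npt z₁ d Q S t v u)) < ∞) :
    ∫⁻ z in nsector z₁ d Q S δt δ (Ico 0 ε),
      Y.indicator (fun x => (∑ i ∈ Finset.range N, ENNReal.ofReal |Ri i x|) * m x) z < ∞ := by
  rw [lintegral_nsector_Ico z₁ d Q S hdet δt δ ε _ (measurable_g3 N hY hm hRi)]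
  refine ENNReal.mul_lt_top ENNReal.ofReal_lt_top ?_
  have h : ∀ t ∈ Ioo (0 : ℝ) δt, ∫⁻ v in Ioo 0 δ, ∫⁻ u in Ioo 0 ε, ENNReal.ofReal (t ^ 2 * v) *
      Y.indicator (fun x => (∑ i ∈ Finset.range N, ENNReal.ofReal |Ri i x|) * m x)
        (npt z₁ d Q S t v u) =
      ∫⁻ v in Ioo 0 δ, ∫⁻ u in Ioo 0 ε, ∑ i ∈ Finset.range N, ENNReal.ofReal (t ^ 2 * v) *
        (ENNReal.ofReal |Ri i (npt z₁ d Q S t v u)| * m (npt z₁ d Q S t v u)) := by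
    intro t ht
    refine setLIntegral_congr_fun measurableSet_Ioo fun v hv =>
      setLIntegral_congr_fun measurableSet_Ioo fun u hu => ?_
    rw [indicator_of_mem (hin t ht v hv u hu), Finset.sum_mul, Finset.mul_sum]
  rw [setLIntegral_congr_fun measurableSet_Ioo h, lintegral₃_finset_sum _ _
    (fun i _ => measurable_piece_npt z₁ d Q S hm hRi i)]
  exact ENNReal.sum_lt_top.2 hpieces

/-- **The finiteness hypothesis of the ray theorems from the global finiteness.** -/
theorem hfin_of_inside3 (hm : Measurable m) {R : (Fin 3 → ℝ) → ℝ}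
    (hR : Measurable R) (hfinY : ∫⁻ x in Y, ENNReal.ofReal |R x| * m x < ∞)
    (hdet : det3 d Q S ≠ 0) {δt δ ε : ℝ}
    (hin : ∀ t ∈ Ioo (0 : ℝ) δt, ∀ v ∈ Ioo (0 : ℝ) δ, ∀ u ∈ Ioo (0 : ℝ) ε, npt z₁ d Q S t v u ∈ Y) :
    ∫⁻ t in Ioo 0 δt, ∫⁻ v in Ioo 0 δ, ∫⁻ u in Ioo 0 ε, ENNReal.ofReal (t ^ 2 * v) *
      (ENNReal.ofReal |R (npt z₁ d Q S t v u)| * m (npt z₁ d Q S t v u)) < ∞ := by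
  have hsub : nsector z₁ d Q S δt δ (Ioo 0 ε) ⊆ Y := fun z hz => by
    obtain ⟨t, ht, v, hv, u, hu, rfl⟩ := (mem_nsector_iff z₁ d Q S δt δ _ z).1 hz
    exact hin t ht v hv u hu
  have hGm : Measurable fun x => ENNReal.ofReal |R x| * m x :=
    (ENNReal.measurable_ofReal.comp (continuous_abs.measurable.comp hR)).mul hm
  have h1 := (lintegral_mono_set (μ := volume) (f := fun x => ENNReal.ofReal |R x| * m x)
    hsub).trans_lt hfinY
  rw [lintegral_nsector z₁ d Q S hdet δt δ measurableSet_Ioo _ hGm] at h1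
  rcases ENNReal.mul_lt_top_iff.1 h1 with ⟨-, h⟩ | h | h
  · exact h
  · exact absurd (ENNReal.ofReal_eq_zero.1 h) (not_le.2 (abs_pos.2 hdet))
  · rw [h]; exact ENNReal.zero_lt_top

/-! ### Nested affine values -/

/-- The `v`-exponent of the nested affine value `α + v (β + u γ)`. -/
def evx (α : ℝ) : ℕ := if α = 0 then 1 else 0

/-- The `u`-exponent of the nested affine value `α + v (β + u γ)`. -/
def eux (α β : ℝ) : ℕ := if α = 0 ∧ β = 0 then 1 else 0

/-- The regular factor of the nested affine value `α + v (β + u γ)`. -/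
def unx (α β γ v u : ℝ) : ℝ :=
  if α ≠ 0 then α + v * (β + u * γ) else if β ≠ 0 then β + u * γ else γ

/-- **Every nested affine value is monomial times regular.** -/
theorem nest_factor (α β γ v u : ℝ) :
    α + v * (β + u * γ) = v ^ evx α * u ^ eux α β * unx α β γ v u := by
  unfold evx eux unx
  by_cases hα : α = 0
  · by_cases hβ : β = 0
    · simp [hα, hβ]; ring
    · simp [hα, hβ]
  · simp [hα]

/-- The exponents vanish when the leading value is non-zero. -/
theorem evx_eux_of_ne {α : ℝ} (hα : α ≠ 0) (β : ℝ) : evx α = 0 ∧ eux α β = 0 := by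
  unfold evx eux
  exact ⟨if_neg hα, if_neg fun h => hα h.1⟩

/-- The `u`-exponent vanishes when one of the two leading values is non-zero. -/
theorem eux_of_ne {α β : ℝ} (h : α ≠ 0 ∨ β ≠ 0) : eux α β = 0 := by
  unfold eux
  rw [if_neg]
  rintro ⟨h1, h2⟩
  rcases h with h | h
  · exact h h1
  · exact h h2

/-- **Two-sided bounds of the regular factor near the corner.** -/
theorem unx_bounds (α β γ : ℝ) (hne : α ≠ 0 ∨ β ≠ 0 ∨ γ ≠ 0) :
    ∃ L > 0, ∃ ε₀ > 0, ∃ η₀ > 0, ε₀ ≤ 1 ∧ η₀ ≤ 1 ∧ ∀ v ∈ Icc (0 : ℝ) ε₀, ∀ u ∈ Icc (0 : ℝ) η₀,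
      L / 2 ≤ |unx α β γ v u| ∧ |unx α β γ v u| ≤ 2 * L := by
  by_cases hα : α ≠ 0
  · -- the constant term leads
    have hL : 0 < |α| := abs_pos.2 hα
    refine ⟨|α|, hL, min 1 (|α| / (2 * (|β| + |γ| + 1))), by positivity, 1, one_pos,
      min_le_left _ _, le_rfl, fun v hv u hu => ?_⟩
    have hux : unx α β γ v u = α + v * (β + u * γ) := by unfold unx; rw [if_pos hα]
    have hsmall : |v * (β + u * γ)| ≤ |α| / 2 := by
      rw [abs_mul, abs_of_nonneg hv.1]
      have h1 : |β + u * γ| ≤ |β| + |γ| + 1 := by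
        calc |β + u * γ| ≤ |β| + |u * γ| := abs_add_le _ _
          _ = |β| + |u| * |γ| := by rw [abs_mul]
          _ ≤ |β| + 1 * |γ| := by
              gcongr
              rw [abs_of_nonneg hu.1]; exact hu.2
          _ ≤ |β| + |γ| + 1 := by linarith [abs_nonneg γ]
      have h2 : v ≤ |α| / (2 * (|β| + |γ| + 1)) := hv.2.trans (min_le_right _ _)
      calc v * |β + u * γ| ≤ |α| / (2 * (|β| + |γ| + 1)) * (|β| + |γ| + 1) :=
            mul_le_mul h2 h1 (abs_nonneg _) (by positivity)
        _ = |α| / 2 := by field_simp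
    rw [hux]
    constructor
    · have := abs_sub_abs_le_abs_sub α (-(v * (β + u * γ)))
      rw [abs_neg, sub_neg_eq_add] at this
      linarith
    · have := abs_add_le α (v * (β + u * γ))
      linarith
  push Not at hα
  by_cases hβ : β ≠ 0
  · -- the `v`-slope leads
    have hL : 0 < |β| := abs_pos.2 hβ
    refine ⟨|β|, hL, 1, one_pos, min 1 (|β| / (2 * (|γ| + 1))), by positivity, le_rfl,
      min_le_left _ _, fun v hv u hu => ?_⟩
    have hux : unx α β γ v u = β + u * γ := by
      unfold unx; rw [if_neg (not_not.2 hα), if_pos hβ]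
    have hsmall : |u * γ| ≤ |β| / 2 := by
      rw [abs_mul, abs_of_nonneg hu.1]
      have h2 : u ≤ |β| / (2 * (|γ| + 1)) := hu.2.trans (min_le_right _ _)
      calc u * |γ| ≤ |β| / (2 * (|γ| + 1)) * (|γ| + 1) :=
            mul_le_mul h2 (by linarith [abs_nonneg γ]) (abs_nonneg _) (by positivity)
        _ = |β| / 2 := by field_simp
    rw [hux]
    constructor
    · have := abs_sub_abs_le_abs_sub β (-(u * γ))
      rw [abs_neg, sub_neg_eq_add] at this
      linarith
    · have := abs_add_le β (u * γ)
      linarith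
  · -- the `u`-slope leads
    push Not at hβ
    have hγ : γ ≠ 0 := by
      rcases hne with h | h | h
      · exact absurd hα h
      · exact absurd hβ h
      · exact h
    have hL : 0 < |γ| := abs_pos.2 hγ
    refine ⟨|γ|, hL, 1, one_pos, 1, one_pos, le_rfl, le_rfl, fun v _ u _ => ?_⟩
    have hux : unx α β γ v u = γ := by
      unfold unx; rw [if_neg (not_not.2 hα), if_neg (not_not.2 hβ)]
    rw [hux]
    constructor <;> linarith

end SepHHK

/-- **A nested thin sector inside the base polyhedron has finite mass as soon as its pieces are
finite in blown-up coordinates** (registered part of `stub_separateHigh`, base dimension `3`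
with fibres; literal form of `SepHHK.nsector_finite`). -/
theorem separateThreeHHK_sector (Y : Set (Fin 3 → ℝ)) (m : (Fin 3 → ℝ) → ENNReal) (Ri : ℕ → (Fin 3 → ℝ) → ℝ) (N : ℕ) (z₁ d Q S : Fin 3 → ℝ) (hY : MeasurableSet Y) (hm : Measurable m) (hRi : ∀ i, Measurable (Ri i)) (hdet : SepHHK.det3 d Q S ≠ 0) (δt δ ε : ℝ) (hin : ∀ t ∈ Set.Ioo (0 : ℝ) δt, ∀ v ∈ Set.Ioo (0 : ℝ) δ, ∀ u ∈ Set.Ioo (0 : ℝ) ε, (fun i => z₁ i + t * (d i + v * (Q i + u * S i))) ∈ Y) (hpieces : ∀ i ∈ Finset.range N, MeasureTheory.lintegral (MeasureTheory.volume.restrict (Set.Ioo 0 δt)) (fun t => MeasureTheory.lintegral (MeasureTheory.volume.restrict (Set.Ioo 0 δ)) (fun v => MeasureTheory.lintegral (MeasureTheory.volume.restrict (Set.Ioo 0 ε)) (fun u => ENNReal.ofReal (t ^ 2 * v) * (ENNReal.ofReal |Ri i (fun i => z₁ i + t * (d i + v * (Q i + u * S i)))| * m (fun i => z₁ i + t *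 (d i + v * (Q i + u * S i))))))) < ⊤) : MeasureTheory.lintegral (MeasureTheory.volume.restrict ((fun w : Fin 3 → ℝ => fun i => z₁ i + w 0 * (d i + w 1 * (Q i + w 2 * S i))) '' {w : Fin 3 → ℝ | w 0 ∈ Set.Ioo 0 δt ∧ w 1 ∈ Set.Ioo 0 δ ∧ w 2 ∈ Set.Ico 0 ε})) (fun z => Y.indicator (fun x => (∑ i ∈ Finset.range N, ENNReal.ofReal |Ri i x|) * m x) z) < ⊤ := by
  exact SepHHK.nsector_finite N z₁ d Q S hY hm hRi hdet hin hpieces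

end Summit.KontsevichZagierPeriods.ArrangementNormalForm.JanusBands
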